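import Summits.BirchSwinnertonDyer.BirchSwinnertonDyer.Theorems.ManinLocalTwoThreeShimuraSectorCapture

/-!
# THEOREM 54 — part 3/4 (§6.3–§7; T-imc-55 G2 + imc g42): THE SHIMURA COCYCLE `E_χ` LIES IN ITS OWN SECTOR, COROLLARY 55.1 (tame
# capture WITHOUT `hE`), THE SECTOR AS A SUBMODULE and LAW 54.M′ TYPED (`SectorRankLawWWE`, CONJECTURE)
# (cell bsd-f2-manin, LENS imc, route `ManinLocalTwoThree`, crux C3 `ManinPrimeToThreeAtNine` stmt-BirchSwinnertonDyer-22968 / C2 `ManinOddAtFour` stmt-22967)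

§6 (T-imc-55, G2, appended 2026-08-31 05:3xZ): **the `hE` antecedent is a THEOREM for TAME characters** — for a prime
`q₀ ∣ N` and `χ₀ : ℤ/q₀ → 𝔽` additive on units with `χ₀(−1) = 0`, `E_{χ₀} = diamondFun N q₀ 𝔽 χ₀` lies in the Eisenstein sector of
signs `diamondSign q₀` (`ε_Q = −1 ⟺ q₀ ∣ Q`) for EVERY `S`, `𝒬` (`isShimuraEisenstein_diamondFun`): parabolic vanishing from
`P = ±gTʷg⁻¹`, `d_P = ±(1 + g₀₀g₁₀w)`, `N ∣ g₁₀²w`; `T_p = p + 1` (tree `heckeU_diamondFun_eq_smul`); **`U_p = p` for `p ∣ N`**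
(`heckeU_diamondFun_of_dvd`: all `p` representatives are `(1 j; 0 p)` and `d' ≡ d (mod N)` — NEW); **the `d`-entry of the
Atkin–Lehner conjugate is `≡ a_γ (mod Q)`, `≡ d_γ (mod N/Q)`** (`apply_one_one_of_conj_atkinLehnerW` — NEW), whence
`W_Q E = −E` (`q₀ ∣ Q`) / `+E` (`q₀ ∣ N/Q`); star by `d_{JγJ} = d_γ`.  COROLLARY 55.1 (`dvd_shimuraIndex_of_sectorMultiplicityOne_tame`):
THEOREM 54 / COR 54.1 for tame `χ = χ₀ ∘ (mod q₀)`, `ℓ` odd, WITHOUT the `hE` hypothesis — the only non-classical input left is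
`SectorMultiplicityOne` (CONJECTURE M1 per tuple; by LAW 54.M′ expected exactly where `s + δ = 1`: `s = 0`, or `s = 1` and `χ₀(q) ≠ 0`).

§7 (appended 2026-08-31 05:5xZ): the sector as an `F`-SUBMODULE `sectorSubmodule N F S 𝒬 ε` (so it has a dimension);
`sectorMultiplicityOne_of_finrank_eq_one` (`finrank = 1 ∧ E_χ ≠ 0 ⟹ SectorMultiplicityOne`); LAW 54.M′ TYPED as the candidate
`@[conjecture] SectorRankLawWWE N ℓ q₀ χ₀ S` («at a tame tuple, `S ⊇ primes ≤ 13`, `𝒬 = 𝒬(N)`: `finrank = s + δ`», `minusOneCount`,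
`splitDelta`, `isTameTuple`, `exactPrimePowerDivisors`: the transplant of Wake–Wang-Erickson, arXiv:1804.06400 Cor. 1.6.1 (1), from
squarefree level to `ℓ² ∥ N`; census: all 77 census-tame levels `N ≤ 2000` consistent, 58 of them HABITAT tuples typed by
`isTameTuple` (habitat clause added g43), ref1 §R311/§R313 93/93; the t-form LAW 54.M died at `N = 1650`).

HONEST FRAMING.  Kernel theorems are unconditional MODULO their typed hypotheses (`SectorMultiplicityOne …` = CONJECTURE M1 per
tuple, open; the `@[conjecture]` rank laws are typed census candidates, NOT theorems).  Nothing about C2/C3, Manin's conjecture or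
BSD is proved here.  Source: imc g42/g43 planner sketch `HOME/imc/g43/Sketch59full.lean` 8602093605f9eb5d (MEMO-imc §53.10, §54, §55),
landed verbatim by LEAD p1 g26 in four parts: 1 `…ShimuraSectorCocycles` (§1–§3), 2 `…ShimuraSectorCapture` (§4 THEOREM 54, §6.1–6.2),
3 `…ShimuraSectorTame` (§6.3–§7), 4 `…ShimuraSectorRankLaw` (§8–§9).
[cite: Mazur1977, II.9 and II.16 (Eisenstein ideal, multiplicity one at prime level)] [cite: Manin1972, Prop. 1.4 / Thm. 1.6]
[cite: Knapp1993, Prop. 11.1, Lemma 9.24] [cite: Shimura1971, §8.1 (8.1.4), §8.3 (8.3.2)] [cite: Stevens1989, §2]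
-/

set_option autoImplicit false
set_option linter.dupNamespace false

noncomputable section

open scoped Classical ComplexConjugate MatrixGroups ModularForm BigOperators

open CongruenceSubgroup Matrix.SpecialLinearGroup Complex
open Literature.NumberTheory.EllipticCurves Literature.NumberTheory.EllipticCurves.ModularForms
open Literature.NumberTheory.EllipticCurves.ModularForms.HidaCohomology
open Summit.BirchSwinnertonDyer.Rank1Residual.ManinAdditive (diamondFun diamondFun_apply)

namespace Summit.BirchSwinnertonDyer.BirchSwinnertonDyer.Theorems.ManinLocalTwoThree.ShimuraSector

section DiamondSector

open Summit.BirchSwinnertonDyer.Rank1Residual.ManinAdditive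

variable {N : ℕ}

/-! ### 6.3 Parabolic vanishing, star, and the sector -/

/-- **`E_χ₀` kills every parabolic element** (`q₀` prime, `χ₀(±1) = 0`): a parabolic `P ∈ Γ₀(N)` is `±g Tʷ g⁻¹` with
`d_P = ±(1 + g₀₀ g₁₀ w)` and `N ∣ g₁₀² w`, so `q₀ ∣ g₁₀ w`-part and `d_P ≡ ±1 (mod q₀)`. [cite: Shimura1971, §1.3–1.5] -/
theorem diamondFun_eq_zero_of_isEigenElt {q₀ : ℕ} (hq₀ : q₀.Prime) (hq₀N : q₀ ∣ N) {F : Type*} [CommRing F]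
    (χ₀ : ZMod q₀ → F) (h1 : χ₀ 1 = 0) (hm1 : χ₀ (-1) = 0) {P : Gamma0 N} {v : Fin 2 → ℤ} (hP : IsEigenElt P v) :
    diamondFun N q₀ F χ₀ P = 0 := by
  funext k
  rw [diamondFun_apply, Pi.zero_apply]
  obtain ⟨g, w, hgw⟩ :=
    Literature.NumberTheory.ModularForms.ParabolicConj.exists_conj_T_zpow_of_isParabolic (isParabolic_of_isEigenElt hP)
  have hcP : (N : ℤ) ∣ ((P : SL(2, ℤ)) 1 0 : ℤ) := (ZMod.intCast_zmod_eq_zero_iff_dvd _ N).mp (Gamma0_mem.mp P.2)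
  have hq₀Z : Prime (q₀ : ℤ) := Nat.prime_iff_prime_int.mp hq₀
  -- `q₀ ∣ g₀₀ g₁₀ w` as soon as `N ∣ g₁₀² w`
  have key : (N : ℤ) ∣ g 1 0 ^ 2 * w → (q₀ : ℤ) ∣ g 0 0 * g 1 0 * w := by
    intro hN
    have hq : (q₀ : ℤ) ∣ g 1 0 ^ 2 * w := dvd_trans (Int.natCast_dvd_natCast.mpr hq₀N) hN
    rcases hq₀Z.dvd_or_dvd hq with h | h
    · exact Dvd.dvd.mul_right (Dvd.dvd.mul_left (hq₀Z.dvd_of_dvd_pow h) _) _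
    · exact Dvd.dvd.mul_left h _
  rcases hgw with h | h
  · have hd : ((P : SL(2, ℤ)) 1 1 : ℤ) = 1 + g 0 0 * g 1 0 * w := by
      show ((P : SL(2, ℤ)) : Matrix (Fin 2) (Fin 2) ℤ) 1 1 = _
      rw [h, coe_conj_T_zpow]; rfl
    have hc10 : ((P : SL(2, ℤ)) 1 0 : ℤ) = -(g 1 0 ^ 2 * w) := by
      show ((P : SL(2, ℤ)) : Matrix (Fin 2) (Fin 2) ℤ) 1 0 = _
      rw [h, coe_conj_T_zpow]; rfl
    have hN : (N : ℤ) ∣ g 1 0 ^ 2 * w := by rw [hc10] at hcP; exact (dvd_neg.mp hcP)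
    obtain ⟨t, ht⟩ := key hN
    rw [hd, ht]
    push_cast
    rw [ZMod.natCast_self, zero_mul, add_zero]
    exact h1
  · have hd : ((P : SL(2, ℤ)) 1 1 : ℤ) = -(1 + g 0 0 * g 1 0 * w) := by
      show ((P : SL(2, ℤ)) : Matrix (Fin 2) (Fin 2) ℤ) 1 1 = _
      rw [h, Matrix.SpecialLinearGroup.coe_neg, Matrix.neg_apply, coe_conj_T_zpow]; rfl
    have hc10 : ((P : SL(2, ℤ)) 1 0 : ℤ) = g 1 0 ^ 2 * w := by
      show ((P : SL(2, ℤ)) : Matrix (Fin 2) (Fin 2) ℤ) 1 0 = _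
      rw [h, Matrix.SpecialLinearGroup.coe_neg, Matrix.neg_apply, coe_conj_T_zpow]
      simp
    have hN : (N : ℤ) ∣ g 1 0 ^ 2 * w := by rw [hc10] at hcP; exact hcP
    obtain ⟨t, ht⟩ := key hN
    rw [hd, ht]
    push_cast
    rw [ZMod.natCast_self, zero_mul, add_zero]
    exact hm1

/-- **`E_χ₀ ∈ parSp`**: additive (a degree-0 cocycle) and zero on parabolic elements. [cite: Hida2022EMI, §4.2.10] -/
theorem diamondFun_mem_parSp {q₀ : ℕ} (hq₀ : q₀.Prime) (hq₀N : q₀ ∣ N) {F : Type*} [CommRing F]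
    (χ₀ : ZMod q₀ → F) (hχ₀ : ∀ a b : ZMod q₀, IsUnit a → IsUnit b → χ₀ (a * b) = χ₀ a + χ₀ b) (hm1 : χ₀ (-1) = 0) :
    diamondFun N q₀ F χ₀ ∈ parSp N F := by
  refine ⟨fun γ δ => ?_, fun P hP => ?_⟩
  · rw [cocycle_zero_mul (diamondFun_mem_cocycles hq₀N χ₀ hχ₀), add_comm]
  · obtain ⟨v, hv⟩ := hP
    exact diamondFun_eq_zero_of_isEigenElt hq₀ hq₀N χ₀ (char_one_eq_zero χ₀ hχ₀) hm1 hv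

/-- `E_χ₀` is star-even (`d_{JγJ} = d_γ`). [folklore] -/
theorem starOp_diamondFun {L' : ℕ} {F : Type*} [CommRing F] (χ₀ : ZMod L' → F) :
    starOp F (diamondFun N L' F χ₀) = diamondFun N L' F χ₀ := by
  funext γ k
  simp only [starOp_apply, diamondFun_apply, starConj_apply_one_one]

/-- The sign vector of `E_χ₀`: `ε_Q = −1` iff `q₀ ∣ Q`. [cite: Mazur1977, II.17] -/
def diamondSign (F : Type*) [CommRing F] (q₀ : ℕ) : ℕ → F := fun Q => if q₀ ∣ Q then -1 else 1

/-- **T-imc-55 (G2): `E_χ₀` LIES IN THE EISENSTEIN SECTOR of signs `diamondSign q₀`** — for every finite set of primes `S`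
and every set `𝒬` of exact divisors (`q₀` prime, `q₀ ∣ N`, `χ₀ : ℤ/q₀ → 𝔽` additive on units, `χ₀(−1) = 0`).
[cite: Mazur1977, II.16–II.17] [cite: DiamondShurman2005, Prop. 5.2.1] [cite: AtkinLehner1970, Lemma 8] -/
theorem isShimuraEisenstein_diamondFun [NeZero N] {F : Type*} [Field F] {q₀ : ℕ} (hq₀ : q₀.Prime) (hq₀N : q₀ ∣ N)
    (χ₀ : ZMod q₀ → F) (hχ₀ : ∀ a b : ZMod q₀, IsUnit a → IsUnit b → χ₀ (a * b) = χ₀ a + χ₀ b) (hm1 : χ₀ (-1) = 0)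
    (S 𝒬 : Finset ℕ) :
    IsShimuraEisenstein N F S 𝒬 (diamondSign F q₀) (diamondFun N q₀ F χ₀) := by
  refine ⟨diamondFun_mem_parSp hq₀ hq₀N χ₀ hχ₀ hm1, fun p _ hp _ hpN => ?_, fun p _ hp _ hpN => ?_,
    fun Q _ hQN hc hQ => ?_, starOp_diamondFun χ₀⟩
  · exact heckeU_diamondFun_eq_smul χ₀ hq₀N hχ₀ hp hpN
  · exact heckeU_diamondFun_of_dvd hp hpN hq₀N χ₀
  · by_cases hqQ : q₀ ∣ Q
    · rw [alOp_diamondFun_of_dvd_self Q hQN hc hqQ χ₀ hχ₀]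
      simp [diamondSign, hqQ]
    · have hqM : q₀ ∣ N / Q := by
        have hN : N = Q * (N / Q) := (Nat.mul_div_cancel' hQN).symm
        rcases (Nat.Prime.dvd_mul hq₀).mp (hN ▸ hq₀N) with h | h
        · exact absurd h hqQ
        · exact h
      rw [alOp_diamondFun_of_dvd_compl Q hQN hc hqM χ₀]
      simp [diamondSign, hqQ]

/-- Dictionary with `SectorMultiplicityOne`'s `χ : ℤ/N → 𝔽`: `E_{χ₀ ∘ (mod q₀)} = E_χ₀`. [folklore] -/
theorem diamondFun_comp_castHom [NeZero N] {q₀ : ℕ} (hq₀N : q₀ ∣ N) {F : Type*} [CommRing F] (χ₀ : ZMod q₀ → F) :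
    diamondFun N N F (fun x => χ₀ (ZMod.castHom hq₀N (ZMod q₀) x)) = diamondFun N q₀ F χ₀ := by
  funext γ k
  simp only [diamondFun_apply, map_intCast]

/-- **The `hE` antecedent of `SectorMultiplicityOne` holds for tame characters** `χ = χ₀ ∘ (mod q₀)` with the sign vector
`diamondSign q₀`. [cite: Mazur1977, II.16–II.17] -/
theorem isShimuraEisenstein_diamondFun_comp [NeZero N] {F : Type*} [Field F] {q₀ : ℕ} (hq₀ : q₀.Prime) (hq₀N : q₀ ∣ N)
    (χ₀ : ZMod q₀ → F) (hχ₀ : ∀ a b : ZMod q₀, IsUnit a → IsUnit b → χ₀ (a * b) = χ₀ a + χ₀ b) (hm1 : χ₀ (-1) = 0)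
    (S 𝒬 : Finset ℕ) :
    IsShimuraEisenstein N F S 𝒬 (diamondSign F q₀) (diamondFun N N F (fun x => χ₀ (ZMod.castHom hq₀N (ZMod q₀) x))) := by
  rw [diamondFun_comp_castHom hq₀N χ₀]
  exact isShimuraEisenstein_diamondFun hq₀ hq₀N χ₀ hχ₀ hm1 S 𝒬

/-- `χ₀(−1) = 0` is automatic in characteristic `≠ 2`. [folklore] -/
theorem char_neg_one_eq_zero {L' : ℕ} {F : Type*} [Field F] (h2 : (2 : F) ≠ 0) (χ₀ : ZMod L' → F)
    (hχ₀ : ∀ a b : ZMod L', IsUnit a → IsUnit b → χ₀ (a * b) = χ₀ a + χ₀ b) : χ₀ (-1) = 0 := by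
  have h := hχ₀ (-1) (-1) isUnit_one.neg isUnit_one.neg
  rw [neg_mul_neg, mul_one, char_one_eq_zero χ₀ hχ₀] at h
  have : (2 : F) * χ₀ (-1) = 0 := by linear_combination -h
  rcases mul_eq_zero.mp this with h0 | h0
  · exact absurd h0 h2
  · exact h0

end DiamondSector

/-! ### 6.4 COROLLARY 55.1: THEOREM 54 / COR 54.1 for TAME characters WITHOUT the `hE` hypothesis -/

section TameCapture

variable {N : ℕ} [NeZero N] {f : CuspForm (Gamma0 N) 2} {ℓ : ℕ} [Fact ℓ.Prime]

/-- The sign vector of `E_χ` as integers (`−1` iff `q₀ ∣ Q`), to feed `w_Q f = ε_Q f`. [cite: Mazur1977, II.17] -/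
def diamondSignZ (q₀ : ℕ) : ℕ → ℤ := fun Q => if q₀ ∣ Q then -1 else 1

/-- The integer sign vector casts to `diamondSign`. [folklore] -/
theorem intCast_diamondSignZ (F : Type*) [CommRing F] (q₀ : ℕ) :
    (fun Q => ((diamondSignZ q₀ Q : ℤ) : F)) = diamondSign F q₀ := by
  funext Q
  by_cases h : q₀ ∣ Q <;> simp [diamondSignZ, diamondSign, h]

/-- **COROLLARY 55.1 (capture ⟹ `ℓ ∣ [Λ₀(f) : Λ₁(f)]`, TAME, `hE` DISCHARGED).**  `f` a newform of level `N`, `q₀ ∣ N` prime,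
`ℓ` odd, `χ₀ : (ℤ/q₀) → 𝔽_ℓ` additive on units and non-trivial, `w_Q f = ε_Q f` on `𝒬` with `ε_Q = −1 ⟺ q₀ ∣ Q`; `ψ : Λ₀(f) → 𝔽_ℓ`
additive, non-zero, star-even and Eisenstein-semilinear on `S`; MULTIPLICITY ONE in the sector (CONJECTURE M1 / LAW 54.M at
this tuple).  THEN `Λ₁(f) ≠ Λ₀(f)` and `ℓ ∣ [Λ₀(f) : Λ₁(f)]`.  The only non-classical input left is `SectorMultiplicityOne`.
[cite: Mazur1977, II.16–II.18] [cite: Manin1972, Thm. 1.9] -/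
theorem dvd_shimuraIndex_of_sectorMultiplicityOne_tame (hf : IsNewform0 f) (S 𝒬 : Finset ℕ)
    {q₀ : ℕ} (hq₀ : q₀.Prime) (hq₀N : q₀ ∣ N) (hℓ2 : (2 : ZMod ℓ) ≠ 0)
    (χ₀ : ZMod q₀ → ZMod ℓ) (hχ₀ : ∀ a b : ZMod q₀, IsUnit a → IsUnit b → χ₀ (a * b) = χ₀ a + χ₀ b)
    (hχ₀nt : ∃ a : ZMod q₀, IsUnit a ∧ χ₀ a ≠ 0)
    (hAL : ∀ Q ∈ 𝒬, ∀ [NeZero Q], Q ∣ N → Nat.Coprime Q (N / Q) →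
      atkinLehnerInvolution N 2 Q f = ((diamondSignZ q₀ Q : ℤ) : ℂ) • f)
    (ψ : ↥(periodLattice f) →+ ZMod ℓ) (hψ0 : ψ ≠ 0)
    (hψT : ∀ p ∈ S, p.Prime → ∀ (x : ↥(periodLattice f)) (hx : cuspCoeff f p * (x : ℂ) ∈ periodLattice f),
      ψ ⟨cuspCoeff f p * (x : ℂ), hx⟩ = (if p ∣ N then (p : ZMod ℓ) else (p : ZMod ℓ) + 1) * ψ x)
    (hψstar : ∀ (x : ↥(periodLattice f)) (hx : conj (x : ℂ) ∈ periodLattice f), ψ ⟨conj (x : ℂ), hx⟩ = ψ x)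
    (hM1 : SectorMultiplicityOne N (ZMod ℓ) S 𝒬 (diamondSign (ZMod ℓ) q₀)
      (fun x => χ₀ (ZMod.castHom hq₀N (ZMod q₀) x))) :
    ∃ φ : ↥(periodLattice f) →+ ZMod ℓ, φ ≠ 0 ∧
      (∀ (x : ℂ) (hx : x ∈ periodLatticeGamma1 f), φ ⟨x, periodLatticeGamma1_le_periodLattice f hx⟩ = 0) ∧
      periodLatticeGamma1 f ≠ periodLattice f ∧ ℓ ∣ (periodLatticeGamma1 f).relIndex (periodLattice f) := by
  have hm1 : χ₀ (-1) = 0 := char_neg_one_eq_zero hℓ2 χ₀ hχ₀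
  have hE := isShimuraEisenstein_diamondFun_comp (N := N) hq₀ hq₀N χ₀ hχ₀ hm1 S 𝒬
  rw [← intCast_diamondSignZ (ZMod ℓ) q₀] at hE hM1
  refine dvd_shimuraIndex_of_sectorMultiplicityOne hf S 𝒬 (diamondSignZ q₀) _ hAL ψ hψ0 hψT hψstar hE hM1 ?_ ?_
  · show χ₀ (ZMod.castHom hq₀N (ZMod q₀) 1) = 0
    rw [map_one]
    exact char_one_eq_zero χ₀ hχ₀
  · obtain ⟨a₀, ha₀, hne⟩ := hχ₀nt
    obtain ⟨u, hu⟩ := ZMod.unitsMap_surjective hq₀N ha₀.unit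
    refine ⟨(u : ZMod N), u.isUnit, ?_⟩
    show χ₀ (ZMod.castHom hq₀N (ZMod q₀) (u : ZMod N)) ≠ 0
    have : ZMod.castHom hq₀N (ZMod q₀) (u : ZMod N) = a₀ := by
      have h := congrArg (fun v : (ZMod q₀)ˣ => (v : ZMod q₀)) hu
      simpa [ZMod.unitsMap_def] using h
    rw [this]
    exact hne

end TameCapture

/-! ## §7 (imc g42) THE SECTOR AS A SUBMODULE and LAW 54.M′ TYPED (`SectorRankLawWWE`, CONJECTURE; census PRED-54M / ref1 §R311)

The Eisenstein sector `{u | IsShimuraEisenstein N F S 𝒬 ε u}` is an `F`-submodule (intersection of `parSp` with kernels of the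
linear maps `T_p − (p+1)`, `U_p − p`, `W_Q − ε_Q`, `⋆ − 1`).  `SectorMultiplicityOne` at a tuple follows from `finrank = 1` (and
`E_χ ≠ 0`).  LAW 54.M′ (MEMO-imc §54.10): at a TAME tuple `(N, ℓ, q₀, χ₀)` the sector of signs `diamondSign q₀` has dimension
`m = s + δ`, `s = #{q prime, q ∥ N, q ∉ {ℓ, q₀}, q ≡ −1 (mod ℓ)}`, `δ = [χ₀(q) = 0 for every such q] ∈ {0, 1}` — the shape of
Wake–Wang-Erickson's `dim J₀(N)[𝔪^ε] = 1 + s + δ` (squarefree level, `p ∤ N`); observed 77/77 tame tuples `N ≤ 2000` (ref1 kit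
j342887 / j342908, §R311: `m = 2` exactly at 558, 585, 630, 774, 1170, 1386, 1710, 1827, 1881, 1962, never `≥ 3`).  The earlier
t-form «`m = 1 + t − r`, `t` = ALL extra exact primes» (LAW 54.M, PRED-54M.tsv 6687cb5937e3846d) scored 76/77 and DIED at
`(1650, ℓ = 5, q₀ = 11)` (predicted 2, observed 1: the extra primes `2, 3 ≢ −1 (mod 5)` do not count) — it is not typed here. -/

section SectorModule

variable (N : ℕ) [NeZero N] (F : Type*) [Field F]

/-- **The Eisenstein sector as an `F`-submodule** of the weight-2 cochains. [cite: Mazur1977, II.9] -/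
def sectorSubmodule (S 𝒬 : Finset ℕ) (ε : ℕ → F) : Submodule F (Gamma0 N → Fin 1 → F) where
  carrier := {u | IsShimuraEisenstein N F S 𝒬 ε u}
  zero_mem' := by
    refine ⟨Submodule.zero_mem _, fun p _ hp _ _ => ?_, fun p _ hp _ _ => ?_, fun Q _ hQN hc _ => ?_, ?_⟩
    · rw [map_zero, smul_zero]
    · rw [map_zero, smul_zero]
    · funext γ i; simp only [alOp_apply, Pi.zero_apply, Pi.smul_apply, smul_eq_mul, mul_zero]
    · funext γ i; simp only [starOp_apply, Pi.zero_apply]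
  add_mem' := by
    intro u v hu hv
    obtain ⟨hu0, huT, huU, huW, huS⟩ := hu
    obtain ⟨hv0, hvT, hvU, hvW, hvS⟩ := hv
    refine ⟨Submodule.add_mem _ hu0 hv0, fun p _ hp hpS hpN => ?_, fun p _ hp hpS hpN => ?_,
      fun Q _ hQN hc hQ => ?_, ?_⟩
    · rw [map_add, huT p hp hpS hpN, hvT p hp hpS hpN, smul_add]
    · rw [map_add, huU p hp hpS hpN, hvU p hp hpS hpN, smul_add]
    · have h1 := huW Q hQN hc hQ
      have h2 := hvW Q hQN hc hQ
      funext γ i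
      have e1 := congrFun (congrFun h1 γ) i
      have e2 := congrFun (congrFun h2 γ) i
      simp only [alOp_apply, Pi.add_apply, Pi.smul_apply, smul_eq_mul] at e1 e2 ⊢
      rw [e1, e2, mul_add]
    · funext γ i
      have e1 := congrFun (congrFun huS γ) i
      have e2 := congrFun (congrFun hvS γ) i
      simp only [starOp_apply, Pi.add_apply] at e1 e2 ⊢
      rw [e1, e2]
  smul_mem' := by
    intro c u hu
    obtain ⟨hu0, huT, huU, huW, huS⟩ := hu
    refine ⟨Submodule.smul_mem _ c hu0, fun p _ hp hpS hpN => ?_, fun p _ hp hpS hpN => ?_,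
      fun Q _ hQN hc hQ => ?_, ?_⟩
    · rw [map_smul, huT p hp hpS hpN, smul_comm]
    · rw [map_smul, huU p hp hpS hpN, smul_comm]
    · have h1 := huW Q hQN hc hQ
      funext γ i
      have e1 := congrFun (congrFun h1 γ) i
      simp only [alOp_apply, Pi.smul_apply, smul_eq_mul] at e1 ⊢
      rw [e1]; ring
    · funext γ i
      have e1 := congrFun (congrFun huS γ) i
      simp only [starOp_apply, Pi.smul_apply] at e1 ⊢
      rw [e1]

omit [NeZero N] in
/-- Membership in the sector submodule is the sector predicate. [folklore] -/
theorem mem_sectorSubmodule_iff (S 𝒬 : Finset ℕ) (ε : ℕ → F) (u : Gamma0 N → Fin 1 → F) :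
    u ∈ sectorSubmodule N F S 𝒬 ε ↔ IsShimuraEisenstein N F S 𝒬 ε u := Iff.rfl

omit [NeZero N] in
/-- **`finrank (sector) = 1` and `E_χ ≠ 0` ⟹ `SectorMultiplicityOne` at the tuple** (so LAW 54.M with `m = 1` gives CONJECTURE
M1 there, and THEOREM 54 / COR 55.1 apply). [folklore] -/
theorem sectorMultiplicityOne_of_finrank_eq_one (S 𝒬 : Finset ℕ) (ε : ℕ → F) (χ : ZMod N → F)
    (hE0 : diamondFun N N F χ ≠ 0) (h1 : Module.finrank F ↥(sectorSubmodule N F S 𝒬 ε) = 1) :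
    SectorMultiplicityOne N F S 𝒬 ε χ := by
  intro hE u hu
  have hne : (⟨diamondFun N N F χ, hE⟩ : ↥(sectorSubmodule N F S 𝒬 ε)) ≠ 0 := by
    intro h0
    apply hE0
    have := congrArg Subtype.val h0
    simpa using this
  obtain ⟨c, hc⟩ := (finrank_eq_one_iff_of_nonzero' _ hne).mp h1 ⟨u, hu⟩
  refine ⟨c, ?_⟩
  have := congrArg Subtype.val hc
  simpa [eq_comm] using this

end SectorModule

section RankLaw

/-- The TAME HABITAT TUPLES of the census (`Bool`-valued, decidable arithmetic): `ℓ` an odd prime, `ℓ² ∥ N`, `q₀ ∥ N` a prime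
with `ℓ ∣ q₀ − 1`, `N/(ℓ² q₀)` squarefree, AND (habitat clause, imc g43 / MEMO-imc §55, COR. 55.C) every other prime `q ∣ N`,
`q ≠ ℓ`, satisfies `q ≡ −1 (mod ℓ)` — in particular `q₀` is the only prime `≡ 1 (mod ℓ)` of `N`.  Without the clause THEOREM 55.B
(§9) predicts `finrank = 1 ≠ s + δ = 2` at `(4095, 3, 13)`. [folklore] -/
def isTameTuple (N ℓ q₀ : ℕ) : Bool :=
  decide (ℓ.Prime ∧ ℓ ≠ 2 ∧ q₀.Prime ∧ ℓ ∣ q₀ - 1 ∧ ℓ ^ 2 ∣ N ∧ ¬ ℓ ^ 3 ∣ N ∧ q₀ ∣ N ∧ ¬ q₀ ^ 2 ∣ N ∧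
    Squarefree (N / (ℓ ^ 2 * q₀)) ∧ ∀ q ∈ N.primeFactors, q ≠ ℓ → q ≠ q₀ → q % ℓ = ℓ - 1)

/-- The exact prime-power divisors `Q ∥ N`, `Q > 1` (the Atkin–Lehner index set `𝒬(N)`). [cite: AtkinLehner1970, §2] -/
def exactPrimePowerDivisors (N : ℕ) : Finset ℕ :=
  N.divisors.filter fun Q => 1 < Q ∧ IsPrimePow Q ∧ Nat.Coprime Q (N / Q)

/-- `s(N, ℓ, q₀) = #{q prime : q ∥ N, q ∉ {ℓ, q₀}, q ≡ −1 (mod ℓ)}` — Wake–Wang-Erickson's count (their `s = #𝒮`,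
arXiv:1804.06400 Thm. 1.5.1, transplanted). [cite: WakeWangErickson2021, Thm. 1.5.1] -/
def minusOneCount (N ℓ q₀ : ℕ) : ℕ :=
  (N.primeFactors.filter fun q => q ≠ ℓ ∧ q ≠ q₀ ∧ ¬ q ^ 2 ∣ N ∧ q % ℓ = ℓ - 1).card

/-- `δ(N, ℓ, q₀, χ₀) ∈ {0, 1}`: `1` iff `χ₀(q) = 0` (i.e. `q` is an `ℓ`-th power mod `q₀`) for EVERY tame `q ≡ −1 (mod ℓ)` (vacuously
`1`) — the transplant of Wake–Wang-Erickson's `δ` («`ℓ₀` splits completely in every `K_{ℓ_i}`, `i ∈ 𝒮`»). [cite: WakeWangErickson2021, Thm. 1.5.1 (4)] -/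
def splitDelta (N ℓ q₀ : ℕ) {F : Type*} [CommRing F] (χ₀ : ZMod q₀ → F) : ℕ :=
  if ∀ q ∈ N.primeFactors.filter (fun q => q ≠ ℓ ∧ q ≠ q₀ ∧ ¬ q ^ 2 ∣ N ∧ q % ℓ = ℓ - 1), χ₀ (q : ZMod q₀) = 0 then 1 else 0

/-- **TYPED CANDIDATE — LAW 54.M′ (`SectorRankLawWWE`, CONJECTURE; imc g42, MEMO-imc §54.10; habitat clause and `S ⊇ {p ∣ N}`
added imc g43, MEMO-imc §55 — the Wake–Wang-Erickson shape; = the tame case of §9's `SectorRankLawUnified`).**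
At a tame HABITAT tuple `(N, ℓ, q₀)` with `χ₀ : (ℤ/q₀) → 𝔽_ℓ` additive on units and non-trivial (the discrete-log character mod `ℓ`),
for every finite set of primes `S ⊇ {p prime : p ≤ 13} ∪ {p ∣ N}` (so `U_p ≡ p` is imposed at EVERY prime of `N`, as both engines do)
and `𝒬 = 𝒬(N)` the exact prime-power divisors: the Eisenstein sector of signs
`ε_Q = −1 ⟺ q₀ ∣ Q` has **`dim_𝔽ℓ = s + δ`**, `s = minusOneCount`, `δ = splitDelta` — the verbatim transplant of
`dim_𝔽p J₀(N)[𝔪^ε] − 1 = s + δ` (Wake–Wang-Erickson, Thm. 1.5.1 / Cor. 1.6.1 (1): squarefree level, `ε = (−1, 1, …, 1)`, `p ≥ 5`,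
`p ∤ N`; «`ℓ₀` splits completely in `K_{ℓ_i}`» ↦ «`ℓ_i` is an `ℓ`-th power mod `q₀`» ↦ `χ₀(ℓ_i) = 0`) to the ADDITIVE level `ℓ² ∥ N`
(`p = ℓ ≥ 3`, parabolic cocycles mod `ℓ`, `U_ℓ = 0`, `W_{ℓ²} = +1`) — a regime no cited theorem covers (all assume `ℓ ∤ N`).  Census
(BC5 witness): all 58 census-tame HABITAT levels `N ≤ 2000` (of 77 tame rows; TABLE-53B d531396d1276d9f7 two-engine certified `≤ 1000`
+ ref1 kit j342887 / j342908 / j342937, §R311, §R313: 93/93 typed instances of the clause-free g42 form, 0 misses);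
`m = 1` cases give `SectorMultiplicityOne` via `sectorMultiplicityOne_of_finrank_eq_one`.  Refutable per tuple by one modular-symbol
computation; pre-registered tests: ref1 kit j342937 (`2000 < N ≤ 3200`), and the tuples with a second prime `≡ 1 (mod ℓ)`
(`(819, q₀ = 7)`, `(1197, q₀ = 19)`: predicted and observed `1`, ref1 §R313 — outside the habitat; explained by THEOREM 55.B, §9).
[cite: WakeWangErickson2021, Thm. 1.5.1, Cor. 1.6.1] [cite: Mazur1977, II.16–II.18] -/
@[conjecture]
def SectorRankLawWWE (N ℓ q₀ : ℕ) [NeZero N] [Fact ℓ.Prime] (χ₀ : ZMod q₀ → ZMod ℓ) (S : Finset ℕ) : Prop :=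
  isTameTuple N ℓ q₀ = true →
    (∀ a b : ZMod q₀, IsUnit a → IsUnit b → χ₀ (a * b) = χ₀ a + χ₀ b) → (∃ a : ZMod q₀, IsUnit a ∧ χ₀ a ≠ 0) →
      (∀ p : ℕ, p.Prime → (p ≤ 13 ∨ p ∣ N) → p ∈ S) →
        Module.finrank (ZMod ℓ) ↥(sectorSubmodule N (ZMod ℓ) S (exactPrimePowerDivisors N) (diamondSign (ZMod ℓ) q₀)) =
          minusOneCount N ℓ q₀ + splitDelta N ℓ q₀ χ₀

end RankLaw

end Summit.BirchSwinnertonDyer.BirchSwinnertonDyer.Theorems.ManinLocalTwoThree.ShimuraSector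

end
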